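import Mathlib.Analysis.SpecialFunctions.Elliptic.Weierstrass
import Mathlib.LinearAlgebra.FreeModule.Finite.CardQuotient
import Mathlib.LinearAlgebra.Matrix.Determinant.Basic
import Mathlib.Analysis.Complex.Basic
import HarnessLib

/-!
# `[Λ : αΛ] = N(α) = α ᾱ` for a multiplier `α` of a lattice `Λ ⊂ ℂ`

Topic `NumberTheory/EllipticCurves`; a proofs-only file (theorems only, no definitions, no named
facts) in `namespace PeriodPair` (deliberate dot-notation extensions of Mathlib's `PeriodPair`).
For a lattice `Λ = ℤω₁ ⊕ ℤω₂ ⊂ ℂ` and a complex number `α ≠ 0` with `αΛ ⊆ Λ` — so that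
`αω₁ = aω₁ + bω₂`, `αω₂ = cω₁ + dω₂` with integers `a, b, c, d` — we prove:

* `PeriodPair.sq_sub_trace_mul_add_det_eq_zero` — `α² − (a + d)α + (ad − bc) = 0`
  (`(α − a)ω₁ = bω₂` and `(α − d)ω₂ = cω₁` multiply to `(α − a)(α − d) = bc`, as `ω₁ω₂ ≠ 0`);
* `PeriodPair.det_eq_mul_conj` — `ad − bc = α ᾱ` (if `α ∉ ℝ`, `α` and `ᾱ` are the two roots of
  that real quadratic; if `α ∈ ℝ` then `b = c = 0`, `a = d = α` by the `ℝ`-independence of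
  `ω₁, ω₂`);
* `PeriodPair.natCard_quotient_range_mulLeft` — **`[Λ : αΛ] = α ᾱ`**: the index in `Λ` of the
  sublattice `αΛ` (the range of multiplication by `α` on `Λ`, a `ℤ`-linear injection) is
  `|det| = ad − bc` (Mathlib's `Submodule.natAbs_det_equiv`, via the matrix of `α` in the basis
  `PeriodPair.latticeBasis`), hence `α ᾱ` as a complex number; in particular the quotient
  `Λ/αΛ` is finite (`PeriodPair.finite_quotient_range_mulLeft`) and `[Λ : αΛ] • z ∈ Λ` whenever
  `αz ∈ Λ` (`PeriodPair.natCard_mul_mem_lattice_of_mul_mem`).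

This is the lattice-theoretic half of "`deg(α) = |L/αL| = N(α)`" (Cox, *Primes of the form
x² + ny²*, §14.B, PDF p. 319, with Thm. 10.14; Silverman, *Advanced Topics*, Cor. II.1.5(b):
`deg [α] = |N^K_ℚ α|`), used for the degree formula of the CM endomorphisms of the nine
class-number-one curves.

## References

* D. A. Cox, *Primes of the form x² + ny²*, 2nd ed., Wiley 2013, Thm. 10.14 and §14.B
  (PDF p. 319). [Cox2013]
* J. H. Silverman, *Advanced Topics in the Arithmetic of Elliptic Curves*, GTM 151 (1994),
  Prop. II.1.2, Cor. II.1.5(b).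
-/

noncomputable section

open scoped ComplexConjugate
open Complex Module

namespace PeriodPair

variable (L : PeriodPair)

/-! ### Coordinates of `αω₁`, `αω₂` and the quadratic relation -/

/-- `ω₁ ≠ 0` (a private copy of the tree's `PeriodPair.ω₁_ne_zero`, `ChudnovskyPeriods.lean`,
to keep the imports minimal). [folklore] -/
private theorem ω₁_ne_zero' : L.ω₁ ≠ 0 := by
  simpa using L.indep.ne_zero 0

/-- `ω₂ ≠ 0` (a private copy of the tree's `PeriodPair.ω₂_ne_zero`). [folklore] -/
private theorem ω₂_ne_zero' : L.ω₂ ≠ 0 := by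
  simpa using L.indep.ne_zero 1

/-- `ℝ`-independence of the periods: `sω₁ + tω₂ = 0` with `s, t ∈ ℝ` forces `s = t = 0`.
[folklore] -/
theorem eq_zero_of_real_combination {s t : ℝ} (h : (s : ℂ) * L.ω₁ + (t : ℂ) * L.ω₂ = 0) :
    s = 0 ∧ t = 0 :=
  LinearIndependent.pair_iff.mp L.indep s t (by simpa [Complex.real_smul] using h)

variable {L}
variable {α : ℂ} {a b c d : ℤ}

/-- **The quadratic relation of a multiplier.**  If `αω₁ = aω₁ + bω₂` and `αω₂ = cω₁ + dω₂` then
`α² − (a + d)α + (ad − bc) = 0`: `(α − a)ω₁ = bω₂` and `(α − d)ω₂ = cω₁` multiply to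
`(α − a)(α − d)ω₁ω₂ = bcω₁ω₂` with `ω₁ω₂ ≠ 0` (Cox, *Primes of the form x² + ny²*, proof of
Thm. 10.14; Silverman, *Advanced Topics*, Prop. II.1.2). [folklore] -/
theorem sq_sub_trace_mul_add_det_eq_zero (h₁ : α * L.ω₁ = a * L.ω₁ + b * L.ω₂)
    (h₂ : α * L.ω₂ = c * L.ω₁ + d * L.ω₂) :
    α ^ 2 - (a + d) * α + (a * d - b * c) = 0 := by
  have hω : L.ω₁ * L.ω₂ ≠ 0 := mul_ne_zero L.ω₁_ne_zero' L.ω₂_ne_zero'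
  have key : (α ^ 2 - (a + d) * α + (a * d - b * c)) * (L.ω₁ * L.ω₂) = 0 := by
    linear_combination (α - d) * L.ω₂ * h₁ + b * L.ω₂ * h₂
  exact (mul_eq_zero.1 key).resolve_right hω

/-- **`ad − bc = α ᾱ`**: the determinant of the multiplier `α` on `Λ = ℤω₁ ⊕ ℤω₂`
(`αω₁ = aω₁ + bω₂`, `αω₂ = cω₁ + dω₂`) is its norm.  If `α ∉ ℝ`, `α` and `ᾱ` are the two
roots of the real quadratic `X² − (a + d)X + (ad − bc)`; if `α ∈ ℝ`, the `ℝ`-independence of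
`ω₁, ω₂` forces `b = c = 0`, `a = d = α` (Cox, Thm. 10.14: `|L/αL| = N(α)`; Silverman, *Advanced
Topics*, Cor. II.1.5(b)). [cite: Cox2013, Thm. 10.14 and §14.B (PDF p. 319)] -/
theorem det_eq_mul_conj (h₁ : α * L.ω₁ = a * L.ω₁ + b * L.ω₂)
    (h₂ : α * L.ω₂ = c * L.ω₁ + d * L.ω₂) :
    ((a * d - b * c : ℤ) : ℂ) = α * conj α := by
  have hq := sq_sub_trace_mul_add_det_eq_zero h₁ h₂
  have hqc : conj α ^ 2 - (a + d) * conj α + (a * d - b * c) = 0 := by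
    have := congrArg conj hq
    simpa only [map_sub, map_add, map_mul, map_pow, map_intCast, map_zero] using this
  push_cast
  by_cases hreal : conj α = α
  · -- `α ∈ ℝ`: `b = 0`, `α = a`; `c = 0`, `α = d`
    have hαre : (α.re : ℂ) = α := by
      apply Complex.ext
      · simp
      · have := congrArg Complex.im hreal
        simp only [Complex.conj_im] at this
        simp only [Complex.ofReal_im]
        linarith
    have e₁ : ((α.re - a : ℝ) : ℂ) * L.ω₁ + ((-b : ℝ) : ℂ) * L.ω₂ = 0 := by
      push_cast; rw [hαre]; linear_combination h₁
    have e₂ : ((-c : ℝ) : ℂ) * L.ω₁ + ((α.re - d : ℝ) : ℂ) * L.ω₂ = 0 := by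
      push_cast; rw [hαre]; linear_combination h₂
    obtain ⟨ha, hb⟩ := L.eq_zero_of_real_combination e₁
    obtain ⟨hc, hd⟩ := L.eq_zero_of_real_combination e₂
    have hb0 : (b : ℂ) = 0 := by exact_mod_cast neg_eq_zero.1 hb
    have hc0 : (c : ℂ) = 0 := by exact_mod_cast neg_eq_zero.1 hc
    have ha' : (a : ℂ) = α := by
      rw [← hαre]; exact_mod_cast (sub_eq_zero.1 ha).symm
    have hd' : (d : ℂ) = α := by
      rw [← hαre]; exact_mod_cast (sub_eq_zero.1 hd).symm
    rw [hb0, hc0, ha', hd', hreal]; ring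
  · -- `α ∉ ℝ`: subtract the two quadratic relations
    have hne : α - conj α ≠ 0 := sub_ne_zero.2 (Ne.symm hreal)
    have htr : (α + conj α - (a + d)) * (α - conj α) = 0 := by linear_combination hq - hqc
    have htr' : α + conj α = a + d := sub_eq_zero.1 ((mul_eq_zero.1 htr).resolve_right hne)
    linear_combination hq - α * htr'

/-! ### The index `[Λ : αΛ]` -/

section Index

variable (L)
variable (hα : ∀ l ∈ L.lattice, α * l ∈ L.lattice)

/-- Multiplication by a multiplier `α ≠ 0`, restricted to `Λ`, is injective. [folklore] -/
theorem restrict_mulLeft_injective (hα0 : α ≠ 0) :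
    Function.Injective ((LinearMap.mulLeft ℤ α).restrict hα) := by
  intro x y h
  apply Subtype.ext
  have := congrArg (fun z : L.lattice ↦ (z : ℂ)) h
  simpa [LinearMap.restrict_apply, mul_right_inj' hα0] using this

/-- Membership in `αΛ` (the range of multiplication by `α` on `Λ`). [folklore] -/
theorem mem_range_restrict_mulLeft_iff {x : L.lattice} :
    x ∈ LinearMap.range ((LinearMap.mulLeft ℤ α).restrict hα) ↔
      ∃ l ∈ L.lattice, (x : ℂ) = α * l := by
  constructor
  · rintro ⟨y, rfl⟩
    exact ⟨y, y.2, rfl⟩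
  · rintro ⟨l, hl, hx⟩
    exact ⟨⟨l, hl⟩, Subtype.ext (by simpa [LinearMap.restrict_apply] using hx.symm)⟩

/-- **`[Λ : αΛ] = α ᾱ`** (Cox, *Primes of the form x² + ny²*, §14.B with Thm. 10.14:
`|L/αL| = N(α)`; Silverman, *Advanced Topics*, Cor. II.1.5(b)).  The index of `αΛ` in `Λ` is the
absolute value of the determinant of multiplication by `α` (Mathlib `Submodule.natAbs_det_equiv`),
which in the basis `ω₁, ω₂` is `ad − bc = α ᾱ` (`det_eq_mul_conj`).
[cite: Cox2013, Thm. 10.14 and §14.B (PDF p. 319)] -/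
theorem natCard_quotient_range_mulLeft (hα0 : α ≠ 0) :
    ((Nat.card (L.lattice ⧸ LinearMap.range ((LinearMap.mulLeft ℤ α).restrict hα)) : ℕ) : ℂ) =
      α * conj α := by
  classical
  haveI : Module.Free ℤ L.lattice := Module.Free.of_basis L.latticeBasis
  haveI : Module.Finite ℤ L.lattice := Module.Finite.of_basis L.latticeBasis
  set g : L.lattice →ₗ[ℤ] L.lattice := (LinearMap.mulLeft ℤ α).restrict hα with hg
  have hginj : Function.Injective g := L.restrict_mulLeft_injective hα hα0
  set N : Submodule ℤ L.lattice := LinearMap.range g with hN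
  -- the index is `|det g|`
  set e : L.lattice ≃ₗ[ℤ] N := LinearEquiv.ofInjective g hginj with he
  have hcomp : N.subtype ∘ₗ AddMonoidHom.toIntLinearMap (e : L.lattice →+ N) = g := by
    ext x
    rfl
  have hcard : (LinearMap.det g).natAbs = Nat.card (L.lattice ⧸ N) := by
    rw [← hcomp]
    exact Submodule.natAbs_det_equiv N e
  -- coordinates of `αω₁`, `αω₂`
  obtain ⟨a, b, hab⟩ := mem_lattice.mp (hα _ L.ω₁_mem_lattice)
  obtain ⟨c, d, hcd⟩ := mem_lattice.mp (hα _ L.ω₂_mem_lattice)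
  -- the matrix of `g` in the basis `ω₁, ω₂`
  set B := L.latticeBasis with hB
  have hg0 : g (B 0) = a • B 0 + b • B 1 := by
    apply Subtype.ext
    simp [hg, LinearMap.restrict_apply, hB, zsmul_eq_mul, hab.symm]
  have hg1 : g (B 1) = c • B 0 + d • B 1 := by
    apply Subtype.ext
    simp [hg, LinearMap.restrict_apply, hB, zsmul_eq_mul, hcd.symm]
  have hdet : LinearMap.det g = a * d - b * c := by
    rw [← LinearMap.det_toMatrix B, Matrix.det_fin_two]
    simp only [LinearMap.toMatrix_apply, hg0, hg1, map_add, map_zsmul, Basis.repr_self,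
      Finsupp.smul_single, smul_eq_mul, mul_one, Finsupp.add_apply, Finsupp.single_apply]
    simp
    ring
  -- `|det| = det = α ᾱ`
  have hnorm : ((a * d - b * c : ℤ) : ℂ) = α * conj α := det_eq_mul_conj hab.symm hcd.symm
  have hnonneg : 0 ≤ a * d - b * c := by
    have h1 : ((a * d - b * c : ℤ) : ℂ) = ((Complex.normSq α : ℝ) : ℂ) := by
      rw [hnorm, Complex.mul_conj]
    have h2 : ((a * d - b * c : ℤ) : ℝ) = Complex.normSq α := by exact_mod_cast h1
    have h3 : (0 : ℝ) ≤ ((a * d - b * c : ℤ) : ℝ) := by rw [h2]; exact Complex.normSq_nonneg α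
    exact_mod_cast h3
  rw [← hcard, hdet, ← hnorm]
  have h : (((a * d - b * c).natAbs : ℕ) : ℤ) = a * d - b * c := Int.natAbs_of_nonneg hnonneg
  have h' : (((a * d - b * c).natAbs : ℕ) : ℂ) = ((((a * d - b * c).natAbs : ℕ) : ℤ) : ℂ) :=
    (Int.cast_natCast _).symm
  rw [h', h]

/-- `Λ/αΛ` is finite (its cardinality is `α ᾱ ≠ 0`). [folklore] -/
theorem finite_quotient_range_mulLeft (hα0 : α ≠ 0) :
    Finite (L.lattice ⧸ LinearMap.range ((LinearMap.mulLeft ℤ α).restrict hα)) := by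
  apply Nat.finite_of_card_ne_zero
  intro h0
  have := L.natCard_quotient_range_mulLeft hα hα0
  rw [h0, Nat.cast_zero] at this
  exact mul_ne_zero hα0 ((map_ne_zero _).2 hα0) this.symm

/-- `[Λ : αΛ] ≠ 0`. [folklore] -/
theorem natCard_quotient_range_mulLeft_ne_zero (hα0 : α ≠ 0) :
    Nat.card (L.lattice ⧸ LinearMap.range ((LinearMap.mulLeft ℤ α).restrict hα)) ≠ 0 := by
  haveI := L.finite_quotient_range_mulLeft hα hα0
  exact Nat.card_pos.ne'

/-- **`[Λ : αΛ]` kills `α⁻¹Λ/Λ`**: if `αz ∈ Λ` then `[Λ : αΛ] • z ∈ Λ` (the class of `αz` in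
the finite group `Λ/αΛ` is killed by its order, so `[Λ : αΛ] αz ∈ αΛ`). [folklore] -/
theorem natCard_mul_mem_lattice_of_mul_mem (hα0 : α ≠ 0) {z : ℂ} (hz : α * z ∈ L.lattice) :
    (Nat.card (L.lattice ⧸ LinearMap.range ((LinearMap.mulLeft ℤ α).restrict hα)) : ℂ) * z ∈
      L.lattice := by
  set N : Submodule ℤ L.lattice := LinearMap.range ((LinearMap.mulLeft ℤ α).restrict hα) with hN
  have hmem : (N.toAddSubgroup.index : ℤ) • (⟨α * z, hz⟩ : L.lattice) ∈ N := by
    have := AddSubgroup.nsmul_index_mem N.toAddSubgroup (⟨α * z, hz⟩ : L.lattice)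
    rw [natCast_zsmul]
    exact this
  have hidx : N.toAddSubgroup.index = Nat.card (L.lattice ⧸ N) := rfl
  obtain ⟨l, hl, hx⟩ := (L.mem_range_restrict_mulLeft_iff hα).1 hmem
  have hx' : ((Nat.card (L.lattice ⧸ N) : ℕ) : ℂ) * (α * z) = α * l := by
    rw [← hidx]
    simpa [zsmul_eq_mul] using hx
  have : (Nat.card (L.lattice ⧸ N) : ℂ) * z = l := by
    apply mul_left_cancel₀ hα0
    linear_combination hx'
  rw [this]
  exact hl

end Index

end PeriodPair

end
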